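import Mathlib
import HarnessLib
import HarnessLib.Audit
import Summits.AtomisticToContinuum.Statement
import Literature.MathematicalPhysics.QuantumManyBody.SwapPurity
import Literature.MathematicalPhysics.QuantumManyBody.PeriodicBoseGasImpurity
import HarnessLib.Audit.Status.Attr

/-!
Route: BECSwapNoCatastrophe

# Route BECSwapNoCatastrophe — no orthogonality catastrophe for the one-pair swap between two copies
of the TORUS gas — Penrose–Onsager II as a two-bath ground-state fidelity, then torus → Dirichlet
transfer

It suffices to show X = TorusSwapBound (card swap-overlap-no-catastrophe, its X moved to the TORUS):
for every repulsive finite-range v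
there is ρ₀ > 0 such that for 0 < ρ < ρ₀ there is c > 0 with: for all large N = n+1 there is δ > 0
such that EVERY δ-near-minimiser Ψ of
the PERIODIC N-body energy on the torus of side L = (N/ρ)^(1/3) has swap purity swapPurity n
(1_cell·Ψ) = tr(γ_Ψ²)/N² ≥ c. Exact
identities: swapPurity = Penrose–Onsager's A₂ (criterion II) = ⟨Ψ⊗Ψ, F(Ψ⊗Ψ)⟩ with F the
transposition x₀ ↔ y₀ between two
INDEPENDENT copies (the n = 1 SWAP estimator of the one-particle-partition Rényi-2 entropy). The
route's claim is that X holds because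
exchanging the dressing clouds of ONE particle pair between two copies of a 3-D dilute superfluid
causes NO Anderson orthogonality
catastrophe (super-ohmic defect spectral weight): the cruxes assert this in integrated form at the
F-symmetric midpoint of the swap path
(TorusHalfSwapOverlap ⇒ X by the midpoint lemma ⟨Φ,FΦ⟩ ≥ 2|⟨Θ,Φ⟩|² − 1) and in differential form
along the path (TorusSwapPathRigidity).
Downstream, X ⇒ PeriodicBEC (the body of shared stmt-0826: constant-mode occupation ≥ cN for
periodic near-minimisers, inlined as the conclusion of SwapToZeroMode) by P–O II
(N·swapPurity ≤ λ_max, PROVED: succ_mul_swapPurity_le_maxOccupation) plus fixed-N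
positivity/translation rigidity (TorusPhaseRigidity,
glue SwapToZeroMode), and PeriodicBEC ⇒ the conjunct by the shared transfer BoundaryTransferWeak
(stmt-0827).
Lean: `∀ v : ℝ → ENNReal,
Literature.MathematicalPhysics.QuantumManyBody.BoseGas.IsRepulsiveFiniteRange v → ∃ ρ₀ : ℝ, 0 < ρ₀ ∧
∀ ρ : ℝ, 0 < ρ → ρ < ρ₀ → ∃ c : ℝ, 0 < c ∧ ∀ᶠ n : ℕ in Filter.atTop, ∃ δ : ENNReal, 0 < δ ∧ ∀ Ψ :
Literature.MathematicalPhysics.QuantumManyBody.BoseGas.PeriodicTrialState (n + 1)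
(Literature.MathematicalPhysics.QuantumManyBody.BoseGas.sideLength ρ (n + 1)),
Literature.MathematicalPhysics.QuantumManyBody.BoseGas.periodicEnergy v Ψ ≤
Literature.MathematicalPhysics.QuantumManyBody.BoseGas.periodicGroundStateEnergy v (n + 1)
(Literature.MathematicalPhysics.QuantumManyBody.BoseGas.sideLength ρ (n + 1)) + δ → ENNReal.ofReal c
≤ Literature.MathematicalPhysics.QuantumManyBody.BoseGas.swapPurity n
((Literature.MathematicalPhysics.QuantumManyBody.BoseGas.cellN (n + 1)
(Literature.MathematicalPhysics.QuantumManyBody.BoseGas.sideLength ρ (n + 1))).indicator Ψ.ψ)`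

## Assembly
Pure logic over typed items: fix v, hv; MidpointLemma turns TorusHalfSwapOverlap into
TorusSwapBound; SwapToZeroMode, fed TorusPhaseRigidity
and TorusSwapBound, yields the PeriodicBEC body (stmt-0826 verbatim, inlined); at v it is exactly
the hypothesis of BoundaryTransferWeak at v, whose conclusion
∃ρ₀ ∀ρ ∈ (0,ρ₀) HasGroundStateBEC v ρ is the conjunct's body at v. Deciding theorem (glue.lean,
elaborates against Sketch.lean rc 0):
`theorem closes (h2 : TorusHalfSwapOverlap) (hM : MidpointLemma) (h6 : TorusPhaseRigidity) (hZ :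
SwapToZeroMode) (h5 : BoundaryTransferWeak) :
BoseEinsteinCondensation := fun v hv => h5 v hv ((hZ h6 (hM h2)) v hv)`. TorusSwapPathRigidity (the
sharp engine, ⇒ rank 2 for bounded v),
TorusStaticImpurityRigidity (first rung) and the waypoint TorusSwapBound are not hypotheses of
`closes`.

Rationale: WHY THIS LINE. Mechanism (card swap-overlap-no-catastrophe): Penrose–Onsager criterion II
(PenroseOnsager1956 §4 (5)–(7); functional = one-particle-partition
Rényi-2 purity, ZozulyaHaqueSchoutens2008, HerdmanEtAl2014) read as a ground-state FIDELITY: for the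
product ground state Φ(0) = Ψ₀⊗Ψ₀ of
H⊕H on the torus, SWAP = ⟨Φ(0), FΦ(0)⟩ is the overlap of the ground states of H⊕H and F(H⊕H)F = H⊕H
+ D, D = Σ_(j≥1)[v(b−x_j) − v(a−x_j) +
v(a−y_j) − v(b−y_j)] a norm-O(1) LOCAL two-body defect (exchange of the dressing clouds of the
tagged pair a = x₀, b = y₀); along the
stoquastic path H(s) = H⊕H + sD (F H(s) F = H(1−s), unique positive ground states) BEC ⇔ no
orthogonality catastrophe, i.e. bounded
Fubini–Study length, whose density χ_F(s) = Σ_m |⟨m|D|0⟩|²/(E_m−E₀)² is an inverse-square spectral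
moment of density fluctuations,
IR-finite in d = 3 exactly because the defect bath is super-ohmic (S(k) ≲ k, ω(k) ≳ k: integrand ∝ k
dk; in d = 1 dk/k — the correct
Lieb–Liniger/Tonks no-BEC side). Imported areas with dictionary: rigorous Anderson-orthogonality
spectral theory (Anderson1967;
GebertKuttlerMuller2014, GebertEtAl2016: overlap exponent = a Hilbert–Schmidt/spectral-shift norm —
there one-body/fermionic, here a
two-body defect in an interacting Bose system with the GOOD sign, no Fermi surface),
quantum-information fidelity geometry
(ZanardiPaunkovic2006, Gu2010: 1 − |⟨Φ(s),Φ(s′)⟩|² ≤ (s−s′)² sup χ_F), the ohmic/super-ohmic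
dictionary of dissipative impurity
models (LeggettEtAl1987; bosonic AOC of a static scatterer: SunRambowSi2004 — catastrophe
e^(−λN^(1/3)) in the IDEAL gas, finite overlap
with interactions; GuentherEtAl2021), rigorous polaron asymptotics (MysliwySeiringer2020) and the
Eisenberg–Lieb SU(2) point
(EisenbergLieb2002) as exact calibration. What this route does that the retired gen-0 route
BECSwapOverlap (Dirichlet) did not: (i) the engine runs on the TORUS — in the Dirichlet box the swap
path is obstructed by a cheap
ONE-BODY effect found while planning: at s = ½ the tagged particle is an impurity of bulk energy
8πρ[a(v/2)+a(v/2)] > 8πρa(v)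
(concavity of coupling ↦ scattering length; = 2μ for hard cores) sitting in the healing-layer well
−μ sech²(x/√2ξ), which is EXACTLY at
threshold for a condensate boson (Pöschl–Teller λ = 1, zero mode tanh) and beyond it for the
impurity (λ(λ+1) = 4κ, κ = a(v/2)/a(v)
∈ (½,1]): an odd surface bound state, binding (λ−1)²μ/2 ≈ 0.158μ at κ = 1 (checked by a shooting
computation, § Numbers), so the
half-swapped Dirichlet ground state localises its tagged particles at the walls and the Dirichlet
midpoint crux 3895 is false although
the endpoint SWAP is untouched; on the torus there are no walls, density is uniform, the one-body
channel vanishes by momentum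
conservation and the soft two-impurity channel is O(L⁻²); (ii) the deciding chain is entirely typed
(midpoint lemma, swap → zero mode = the
PeriodicBEC body of stmt-0826, shared BoundaryTransferWeak stmt-0827) and `closes` elaborates; (iii)
P–O II is now a PROVED Literature lemma. Versus open routes: BECCutLineWeakDisorder
needs an UPPER bound on a two-replica intersection functional of one tagged line in one bath — here
two baths, one swap, a LOWER bound
on an overlap; BECIroning/BECPhononFloor/BECLaplacianL1 are mode-by-mode infrared bounds, this line
is mode-free up to the fixed-N step. Negatives index (6 entries, 1 on BEC: SwapJensen misstated over
C) steered clear of.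

RANKED CRUXES. #0 TorusSwapBound (target) — X as in § Thesis: uniform lower bound c > 0 on the swap
purity tr(γ_Ψ²)/N² = swapPurity n (1_cell^N · Ψ.ψ) of δ-near-minimisers of the periodic (n+1)-boson
energy on the torus of side ((n+1)/ρ)^(1/3), every repulsive finite-range v (hard cores included),
all small ρ, all large n, δ after n. Reached from rank 2 by MidpointLemma; feeds PeriodicBEC through
SwapToZeroMode. (why it might fail: Near-minimiser-wise equivalent to mode-free torus BEC
((λ_max/N)² ≤ SWAP ≤ λ_max/N, PenroseOnsager1956 (5)): as strong as the T = 0 problem on the torus;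
all content sits in ranks 2–3; needs E₀^per < ⊤ eventually (true below close packing).)
[PenroseOnsager1956, ZozulyaHaqueSchoutens2008, HerdmanEtAl2014, LiebSeiringerSolovejYngvason2005,
Fournais2020]
#2 TorusHalfSwapOverlap (crux) — THE HALF-SWAPPED TORUS GROUND STATE REMEMBERS THE PRODUCT (card S2,
integrated AOC form, all v incl. hard cores). Two copies of the torus (ℝ³/Lℤ³)^N, N = n+1, L =
(N/ρ)^(1/3); tag particle 0 of each copy (a = x₀, b = y₀). E2 = the two-copy periodic quadratic form
on the cell [0,L)^(3N) × [0,L)^(3N) with bath–bath interactions v^per inside each copy and each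
tagged particle coupled at HALF strength to BOTH baths (Σ_j ½[v^per(a−x_j) + v^per(b−y_j) +
v^per(b−x_j) + v^per(a−y_j)], ½·⊤ = ⊤), over the admissible class Adm = {Θ : C¹, Lℤ³-periodic in
every coordinate of both copies, F-symmetric (Θ∘F = Θ, F : x₀ ↔ y₀), ∫_cell² |Θ|² = 1}. Claim:
∃ρ₀(v) ∀ρ ∈ (0,ρ₀) ∃η > 0 ∀ᶠn ∃δ > 0: every periodic δ-near-minimiser Ψ of the one-copy energy and
every δ-near-minimiser Θ of E2 within Adm satisfy |⟨Θ, Ψ⊗Ψ⟩_cell²|² ≥ ½ + η. Ground-state reading: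
α² = |⟨Ψ₀⊗Ψ₀, Φ(½)⟩|² > ½ uniformly in N (two independent condensates vs. one pair shared half–half
cannot be told apart; expected 1 − α² = O(C(v)√(ρa³))). Implied by rank 3 for bounded v (chord s = 0
→ ½, bosonic = absolute infimum, Ψ⊗Ψ a 2δ-near-minimiser of E2(0)). [difficulty: open-problem] (why
it might fail: No uniform-in-N control of an overlap of 2N-body ground states differing by an O(1)
local two-body defect exists for an interacting continuum gas (two gapless baths); a v-dependent
O(1) deficit surviving ρ → 0 (UV of the half-coupled pair; hard cores: midpoint impurity energy 2μ)
breaks the ½.) [Anderson1967, GebertKuttlerMuller2014, SunRambowSi2004, GuentherEtAl2021,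
EisenbergLieb2002, PenroseOnsager1956]
#3 TorusSwapPathRigidity (crux) — NO ORTHOGONALITY CATASTROPHE ALONG THE TORUS SWAP PATH (card S2/S3
in fidelity form; bounded finite-range v, for which the path is non-degenerate). Same two-copy
torus; for s ∈ [0,1] let E2(s) be the periodic form with bath–bath interactions plus Σ_j
(1−s)[v^per(a−x_j) + v^per(b−y_j)] + s[v^per(b−x_j) + v^per(a−y_j)] (H(0) = H⊕H, H(1) = F H(0) F, F
H(s) F = H(1−s), all stoquastic), Adm = {C¹, periodic in both copies, normalised on cell²}. Claim:
∀ε > 0 ∃ρ₀(ε,v) ∀ρ ∈ (0,ρ₀) ∀ᶠn ∀s,s′ ∈ [0,1] ∀τ > 0 ∃δ > 0: δ-near-minimisers Θ of E2(s) and Θ′ of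
E2(s′) in Adm satisfy |⟨Θ,Θ′⟩_cell²|² ≥ 1 − ε(s−s′)² − τ. Ground-state reading: the positive ground
states Φ(s) move with Fubini–Study speed ≤ √ε, i.e. sup_s χ_F(s) ≤ ε for ρ < ρ₀(ε) UNIFORMLY IN N
(Bogoliubov count: χ_F = O((∫v)²√(ρ/a)), small-k integrand ∝ k dk in d = 3, dk/k in d = 1; see §
Cheapest falsifier). At (s,s′) = (0,1): SWAP(Ψ₀)² ≥ 1 − ε — complete condensation as ρ → 0.
[difficulty: open-problem] (why it might fail: Asserts sup_s χ_F(s) → 0 as ρ → 0 uniformly in N: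
needs inverse-square spectral moments of density fluctuations down to k = 2π/L (S(k) ≲ k and a
Landau floor ω(k) ≳ k, open beyond GP scaling: Seiringer2011) plus domination beyond second order;
finiteness is Bogoliubov-level only (SunRambowSi2004).) [Anderson1967, GebertKuttlerMuller2014,
GebertEtAl2016, ZanardiPaunkovic2006, Gu2010, SunRambowSi2004, Seiringer2011, LeggettEtAl1987,
Literature.Barriers.AtomisticToContinuum.BogoliubovPerturbationInfrared]
#4 TorusStaticImpurityRigidity (crux) — FIRST RUNG: NO CATASTROPHE FOR A PINNED SCATTERER IN THE
DILUTE INTERACTING TORUS GAS, UNIFORMLY IN THE VOLUME (bounded finite-range v). One copy, N bosons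
on the torus of side (N/ρ)^(1/3), plus a static impurity at z coupled through the SAME pair
potential with strength t: E_t(Φ) = periodicEnergy v Φ + t ∫_cell Σ_j v^per(x_j − z)|Φ|²
(impurityInteraction of PeriodicBoseGasImpurity). Claim: ∀ε > 0 ∃ρ₀(ε,v) ∀ρ ∈ (0,ρ₀) ∀ᶠN ∀z ∀t,t′ ∈
[0,1] ∀τ > 0 ∃δ > 0: δ-near-minimisers Φ of E_t and Φ′ of E_t′ (periodic trial states) satisfy
|⟨Φ,Φ′⟩_cell|² ≥ 1 − ε(t−t′)² − τ. Ground-state reading: the infinite-mass Bose-polaron residue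
Z_N(t) → 1 as ρ → 0 uniformly in N (one-loop exponent ρ∫d³k |v̂|² S/ω² ∝ (∫v)²√(ρ/a) in d = 3; it
DIVERGES for the ideal gas, whose overlap is e^(−λN^(1/3))). Worst case of the engine (no recoil,
one bath): the test-bed for ranks 2–3, not on the deciding chain. [difficulty: XL] (why it might
fail: Finite residue is Bogoliubov-level only (SunRambowSi2004 eq. (22); GuentherEtAl2021): the
ideal gas HAS a catastrophe (overlap e^(−λN^(1/3))), so a proof must use S(k) ≲ k/c of the
interacting state down to k = 2π/L — an O(1)-precision response bound inside an O(N) energy; none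
exists.) [SunRambowSi2004, GuentherEtAl2021, MysliwySeiringer2020, LampartTriay2025,
AstrakharchikPitaevskii2004, PitaevskiiStringari1991,
Literature.Barriers.AtomisticToContinuum.KineticGapLengthScales]
#5 BoundaryTransferWeak (crux) — (shared item stmt-AtomisticToContinuum-0827, verbatim) mode-free
boundary-condition transfer, per potential: for each repulsive finite-range v, the PeriodicBEC body
for v (constant-mode occupation ≥ cN for periodic δ-near-minimisers on the torus of side
(N/ρ)^(1/3), all small ρ) implies ∃ρ₀ > 0 ∀ρ ∈ (0,ρ₀) HasGroundStateBEC v ρ (Dirichlet, λ_max via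
condensateNumber). Expected engine: Neumann bracketing of interior sub-boxes + the mode-free
criterion λ_max ≥ tr γ²/N (card wall-dressing-transfer is a candidate mechanism); wanted also by
BECIroning, BECPhononFloor. [difficulty: L] (why it might fail: Torus hypothesis never fires on the
Dirichlet ground state (wall energy ≫ δ above E₀^per; interior restrictions not periodic/sharp-N):
no energy comparison; print transfers only the ENERGY across b.c. (LSSY2005 Ch. 2) — a condensate
transfer is not in print; BEC is b.c.-sensitive (Robinson1976).) [LiebSeiringerSolovejYngvason2005,
Junge2026, BoccatoSeiringer2023, Basti2022, Robinson1976]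
#6 TorusPhaseRigidity (crux) — FIXED-N PHASE RIGIDITY ON THE TORUS (uniqueness of the periodic
ground state in near-minimiser language; the only ground-state input of the glue SwapToZeroMode): ∀v
∃ρ₀ ∀ρ ∈ (0,ρ₀) ∀ᶠN ∀η > 0 ∃δ > 0: any two periodic δ-near-minimisers Ψ, Φ on the torus of side
(N/ρ)^(1/3) satisfy ∫_cell^N |Ψ − cΦ|² ≤ η for some unit complex c (E₀^per < ⊤, compact resolvent,
unique positive ground state and spectral gap at fixed N; for hard cores via connectedness /
energetic dominance of the dilute component of the hard-sphere configuration space of the torus).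
Torus twin of GroundStateRigidity (stmt-3298, Dirichlet). With periodicEnergy_translate (PROVED) it
yields approximate translation invariance of near-minimisers up to phase. [difficulty: M] (why it
might fail: Automatic for bounded v (positivity improving, ReedSimonIV1978 XIII.12/47), but for hard
cores the torus hard-sphere configuration space may disconnect (sparse jammed frames wrapping the
torus; Kahle2012, BaryshnikovBubenikKahle2013) unless caged components are excluded energetically.)
[ReedSimonIV1978, Kahle2012, BaryshnikovBubenikKahle2013, LiebSeiringerSolovejYngvason2005]
#9 MidpointLemma (support) — TorusHalfSwapOverlap → TorusSwapBound (pure Hilbert-space algebra +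
Fubini). Fix v, ρ, η, n, δ from rank 2; for a periodic δ-near-minimiser Ψ pick ONE F-symmetric
δ-near-minimiser Θ of E2 in Adm (exists: Adm ∋ the normalised constant, so either inf = ⊤ and any
member works or iInf < iInf + δ); with Φ = 1_cell²·Ψ⊗Ψ (unit vector by Fubini + norm_eq) and U : Θ ↦
Θ∘F a unitary self-adjoint involution of L²(cell²) (F measure-preserving), P = (1+U)/2: ⟨Φ,UΦ⟩ =
2‖PΦ‖² − 1 ≥ 2|⟨Θ,Φ⟩|² − 1 ≥ 2η (Θ = PΘ unit), and ⟨Φ,UΦ⟩ = ∫∫|∫Ψ(x::X̂) conj Ψ(x::Ŷ) dx|² =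
swapPurity n (1_cell^N·Ψ.ψ) (lintegral_config_succ, swapPurity_eq_lintegral_lintegral of
SwapPurity.lean); c = 2η. [deps: TorusHalfSwapOverlap, TorusSwapBound] [difficulty: M]
[PenroseOnsager1956, HerdmanEtAl2014]
#9 SwapToZeroMode (support) — TorusPhaseRigidity → TorusSwapBound → PeriodicBEC, the latter written
out verbatim as the body of the shared item stmt-AtomisticToContinuum-0826 (constant-mode occupation
≥ cN for periodic δ-near-minimisers; = the hypothesis of BoundaryTransferWeak) so that the file
order is immaterial (mode-free → constant mode at fixed N; operator-free, inputs in tree or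
elementary). For large N = n+1 with c, δ₁ from X, δ(η) from rigidity, η = (c/8)²: (1) a NONNEGATIVE
periodic near-minimiser Φ₊ exists at every slack (diamagnetic smoothing |Ψ|²/(|Ψ|²+ε²)^(1/2)
renormalised: C¹, periodic, symmetric, vanishes where Ψ does, kinetic term → ∫|∇|Ψ||² ≤ ∫|∇Ψ|² at
fixed N); (2) translates of Φ₊ are near-minimisers (periodicEnergy_translate, PROVED), so rigidity
gives ‖T_tΦ₊ − c_tΦ₊‖² ≤ η ∀t; (3) for every normalised mode φ, occupation(T_tφ,Φ₊)^(1/2) ≥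
occupation(φ,Φ₊)^(1/2) − √(Nη), and the t-average of occupation(T_tφ,Φ₊) is ⟨φ,γ̄φ⟩, γ̄ =
translation average of γ_Φ₊ = convolution by ḡ ≥ 0 (Φ₊ ≥ 0) with ĝ(k) ≤ ĝ(0) =
condensateOccupation(Φ₊); sup over φ and P–O II (succ_mul_swapPurity_le_maxOccupation, PROVED) give
n₀(Φ₊) ≥ (√λ_max − √(Nη))² ≥ N(c − 2√η); (4) any δ-near-minimiser Ψ is η-close to cΦ₊, so n₀(Ψ) ≥
N(c − 4√η) = cN/2; δ = min(δ₁, δ(η)); E₀^per < ⊤ is forced by X itself. [deps: TorusPhaseRigidity,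
TorusSwapBound] [difficulty: L] [PenroseOnsager1956, LiebSeiringerSolovejYngvason2005, Fournais2020]

TWO-LAYER PLAN. Foreseen glued splits (nothing filed now). TorusHalfSwapOverlap ⇐
TorusSwapPathRigidity → TwoCopyPerronFrobenius → TorusHalfSwapOverlap
for bounded v (glue: chord s = 0 → ½ of rank 3; TwoCopyPerronFrobenius = fixed-n facts: inf over Adm
of E2(0) = 2E₀^per (bosonic =
absolute infimum, slicing), F-symmetric infimum = absolute infimum at s = ½, so Ψ⊗Ψ and F-symmetric
near-minimisers are near-minimisers
in rank 3's class) plus a separate child HardCoreHalfSwap (hard cores: the path is degenerate, ½·⊤ =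
⊤, so rank 2 must be attacked
directly — positivity/Feynman–Kac of the two-copy measure, or a core-RADIUS deformation r_A(s) +
r_B(s) ≤ a which keeps the impurity's
scattering length ≤ a). TorusSwapPathRigidity ⇐ SpectralInput → AdiabaticDomination →
TorusSwapPathRigidity once a vocabulary for
excited states exists: SpectralInput = S_N(k) ≤ C|k| (hyperuniformity) ∧ a Landau-type lower bound
inf spec H|_(P=k) − E₀ ≥ c_L|k| down to
k = 2π/L, giving Σ_m |⟨m|D|Φ(s)⟩|²/(E_m − E(s))² ≤ C(v)√ρ; AdiabaticDomination =
second order controls the path (the card's 'cumulant domination'). BoundaryTransferWeak ⇐ (Neumann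
bracketing of interior cells) → (swap
purity of cell restrictions ≥ c′, mode-free) → BoundaryTransferWeak, the engine proposed by card
wall-dressing-transfer; shared with
BECIroning / BECPhononFloor, whichever route gets there first.

KILL CRITERIA. (i) A computation or theorem showing the swap-defect fidelity susceptibility χ_F(s)
grows with L on the 3-D TORUS (log L or a power — e.g.
through the Gavoret–Nozières pair channel, or an overlooked soft two-impurity channel) refutes
TorusSwapPathRigidity; if the growth is
intrinsic to s ∈ (0,½] the engine dies: close `refuted:TorusSwapPathRigidity` unless
TorusHalfSwapOverlap survives by a non-differential
(positivity) argument. (ii) ¬TorusHalfSwapOverlap while torus BEC is still expected (midpoint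
overlap ≤ ½ although SWAP stays ≥ c, e.g.
by an s = ½ binding effect I have not seen on the torus — the Dirichlet analogue IS killed this way
by surface binding, see § Why) means
the AOC reading is wrong at its load-bearing point: close `refuted:TorusHalfSwapOverlap`. (iii)
¬TorusStaticImpurityRigidity (a
catastrophe for a pinned scatterer in the interacting dilute torus gas, uniformly in L) falsifies
the super-ohmic premise: close.
(iv) ¬TorusPhaseRigidity for hard cores (degenerate torus ground states from jammed components at
low density) forces a pivot of the
glue to 'bounded v first' + a Dyson-lemma softening child, not a close. (v) ¬TorusSwapBound is
¬(torus BEC) near-minimiser-wise — it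
kills every torus route, hand to the negatives index. Mooted: any proof of PeriodicBEC (then only
BoundaryTransferWeak matters) or of
the conjunct.

NOT DECOMPOSED YET. The two glues named in the two-layer plan (chord/Perron–Frobenius identification
at fixed n; hard-core child of rank 2); the reduction
of TorusSwapPathRigidity to spectral inputs (hyperuniformity + Landau floor ⇒ inverse-square moment
⇒ adiabatic domination) — the
card's S3, informal until a vocabulary for excited states / reduced resolvents / S(k,τ) exists; the
Eisenberg–Lieb λ-family (two-SPECIES
mixture H_A + H_B + λV_AB on the torus, ⟨F⟩ = (⟨S²⟩ − N)/N² = 1 at λ = 1 by EisenbergLieb2002) —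
calibration only, since d⟨F⟩/dλ is a
cross-susceptibility with a soft spin mode near λ = 1; the Dirichlet-native variant with a
range-scaled anti-binding path
(v(·/λ_A(s)), v(·/λ_B(s)), λ_A + λ_B < 1, which keeps the impurity below the surface-binding
threshold) — kept in reserve in case
BoundaryTransferWeak stalls for all routes; positive temperature.

CHEAPEST FALSIFIER. Bogoliubov computation (pen-and-paper, or kit for a refuter) of the swap-defect
fidelity susceptibility on the TORUS of side L at fixed
ρa³ ∈ [10⁻⁴,10⁻²], including the s-dependence: χ_F(s;L) = Σ_(m≠0)|⟨m|D|0⟩|²/(E_m−E₀)² must CONVERGE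
as L → ∞ uniformly in s (to
≈ C(∫v)²√(ρ/a)). My hand count: single-phonon + recoil channels 4ρ∫d³k/(2π)³|v̂|²S/(ω_k+k²)² finite
(∝ k dk at small k; UV piece
ρ|v̂(0)|²ξ/(8π²) ∝ √ρ); soft two-impurity channel (a:k, b:−k, denominator 2k²) has matrix element
O(s g/V) and Σ_k k⁻⁴ ∝ L⁴ ⇒ O(L⁻²);
cross terms O(1/N); induced a–b Yukawa U₀ξ² ≈ 3v̂(0)/(16πξ) → 0 (no bipolaron). A log L (pair
channel k,−k with denominator 2ω_k at
s > 0, which I estimate O(1/V)·finite, or anything missed) kills rank 3 and makes rank 2 suspect.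
Calibration: d = 1 must diverge like
log L (Tonks, HerdmanDelmaestro2015); ideal gas + fixed scatterer like N^(1/3) (SunRambowSi2004).
Not run numerically (compute-free hub);
the Dirichlet surface-binding check WAS run (shooting for −u″ + 4κ tanh²y·u: no bound state at κ =
½; binding/μ = 0.002, 0.008, 0.046,
0.158 at κ = 0.55, 0.6, 0.75, 1 = Pöschl–Teller (λ−1)²/2) — the reason the engine moved to the
torus.

NUMBERS. Bogoliubov (LiebSeiringerSolovejYngvason2005 Ch. 5; BoccatoEtAl2019Acta): condensate
fraction 1 − (8/(3√π))√(ρa³), so SWAP ≈ n₀² ≈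
1 − 3.0√(ρa³) (ρa³ = 10⁻³: SWAP ≈ 0.905); healing length ξ = (8πρa)^(−1/2), sound speed √(16πρa) (ħ
= 2m = 1); S(k) = k²/ω_k, ω_k =
k√(k² + 16πρa); defect fidelity susceptibility χ_F ≈ C(∫v)²√(ρ/a) → 0 as ρ → 0 at fixed v (the small
parameter of ranks 2–4); static
scatterer in the IDEAL gas: overlap e^(−λN^(1/3)) in d = 3 (SunRambowSi2004 abstract/(10)), with
Bogoliubov interactions e^(−λ′/√U) finite
(their (22)–(23)); d = 1 Tonks gas: λ_max ≈ 1.54√N (Lenard1964, ForresterFrankelGaroni2003) so SWAP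
≤ λ_max/N → 0. Dirichlet surface
well −μ sech²(x/√2ξ): impurity with κ = a(v/2)/a(v) ∈ (½,1] sees Pöschl–Teller λ(λ+1) = 4κ, odd
bound state iff κ > ½, binding
(λ−1)²μ/2 = 0.158μ at κ = 1. Items at open: 9 (1 target,
5 cruxes of which 1 shared, 2 supports, 1 assembly).

DEFINITION REQUESTS. None blocking: the two-copy / pinned-scatterer forms are inlined with `let`
(Sketch.lean rc 0, 2026-08-15); every constant exists in
Literature/MathematicalPhysics/QuantumManyBody/{BoseEinsteinCondensation, PeriodicBoseGas,
PeriodicBoseGasImpurity, SwapPurity}.lean.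
Desirable later: (a) a problem-side vocabulary `TwoCopyTorus` (two-copy periodic admissible class,
swap map F, s-coupled form E2(s)) under
…/BoseEinsteinCondensation/Theorems to shorten ranks 2–3 and their glue; (b) a Literature vocabulary
for excited states of the periodic
form (reduced resolvent, S(k,τ)) to TYPE the spectral input of layer 2; (c) cite fact wanted:
EisenbergLieb2002 main theorem.

Novelty: Searches (2026-08-15, this seat): `lit galaxy search "orthogonality catastrophe" --star all` (21
rows: panama 10 textbook hits —
Giamarchi–Millis Les Houches, Coleman, Nazarov–Blanter; pdf 10 incl. arXiv:cond-mat/0404590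
Sun–Rambow–Si 'Orthogonality catastrophe in
Bose–Einstein condensates' (READ pp. 1–4: ideal-gas overlap e^(−λN^(1/3)), Bogoliubov super-ohmic Im
χ₀⁻¹ ∝ ω^d ⇒ finite) and the
St Andrews thesis 'New developments in orthogonality catastrophe physics'); `lit search --source
crossref` ×2 ("orthogonality catastrophe
two Bose–Einstein condensates overlap swap", "… Sun Rambow Si": two-component BEC experiment
chapters only); `lit frontier
AtomisticToContinuum --since 2022` (30 rows; BEC side arXiv:2510.20493, arXiv:2603.20776,
arXiv:2602.16566, arXiv:2605.06844 — energy /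
localisation currency, none on overlaps); arXiv leg HTTP 429, local searchd/graph unavailable this
session (D-0023 off-box, logged).
Inherited and re-read: the card's audit-37 searches (ZozulyaHaqueSchoutens2008 / HerdmanEtAl2014
define the functional; GuentherEtAl2021;
LeggettEtAl1987 dictionary) and the gen-0 route's crossref sweep (doi:10.1103/physreva.103.013317,
doi:10.4171/jst/135,
doi:10.1103/physrevlett.89.220403, doi:10.1103/physrevb.91.184507, doi:10.1103/physreve.79.061125).
In-pool: retired routes
BECSwapOverlap (Dirichlet twin, gen 0), BECSwapAffinity, BECImpurityMassFlow (its
StaticNoCatastrophe 3906 is the position-shift cousin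
of rank 4), open BECCutLineWeakDisorder.
Nearest prior ar  [refs: 10.1103/physreva.103.013317, 10.4171/jst/135, 10.1103/physrevlett.89.220403, 10.1103/physrevb.91.184507, 10.1103/physreve.79.061125, cond-mat/0404590, 2510.20493, 2603.20776, 2602.16566, 2605.06844, doi:10.1103/physreva.103.013317, doi:10.4171/jst/135, doi:10.1103/physrevlett.89.220403, doi:10.1103/physrevb.91.184507, doi:10.1103/physreve.79.061125, ZozulyaHaqueSchoutens2008, HerdmanEtAl2014, Guen]

Barriers (technique_class: AOC-overlap two-copy-swap fidelity-susceptibility): - technique_class: AOC-overlap two-copy-swap fidelity-susceptibility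
- Literature.Barriers.AtomisticToContinuum.KineticGapLengthScales: evaded in the statements — no
step bounds depletion by (box side)² × (excess energy); L enters only as the infrared end k ≥ 2π/L
of an inverse-square spectral moment that converges in d = 3 with one power to spare (∫k dk); honest
caveat: the layer-2 spectral input needs a Landau-type floor on density-excitation energies down to
k ~ 2π/L, and if the only road to it is gap bookkeeping the barrier re-enters there (why-might-fail
of rank 3); the fixed-N gap used in TorusPhaseRigidity is harmless (δ after N, no uniformity
claimed).
- Literature.Barriers.AtomisticToContinuum.KineticGapLengthScalesNarrow: its Galilei-boost witness
(decondensed states inside the kinetic gap window) is exactly why every item here fixes δ AFTER N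
(exact-ground-state properties), never a window κN/L².
- Literature.Barriers.AtomisticToContinuum.EnergyAsymptoticsWithoutCondensation: evaded — no energy
asymptotics are matched; the objects are overlaps of ground states; the 1-D Lieb–Liniger witness
sits on the right side (ohmic defect ⇒ catastrophe ⇒ SWAP → 0, no BEC claimed).
- Literature.Barriers.AtomisticToContinuum.BogoliubovPerturbationInfrared: partially applies — a
bare expansion of Φ(s) in v meets the T = 0 infrared problem (Gavoret–Nozières pair channel); the
route's quantities are second-order responses to a gauge-invariant LOCAL density coupling, IR-finite
by pow

History (route lifecycle, newest last):
- 2026-08-25T05:46:43Z · DORMANT — reconciler: no traction for 7.4 d (last activity item-evidence-added at 2026-08-17T19:03:04Z); parked, not closed — `ledger route dormant route-AtomisticToConti (operator:999:3160909)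
- 2026-08-29T03:29:18Z · REACTIVATED — reconciler: reactivated — activity statement-checked at 2026-08-29T01:17:37Z after parking at 2026-08-25T05:46:43Z (operator:999:312843)

sub-problem: BoseEinsteinCondensation · status: open · opened planner-plancard-AtomisticToContinuum-BoseEin-a26c992a-g2-0 2026-08-15T19:08:04Z · rev 4 · ledger route-AtomisticToContinuum-BECSwapNoCatastrophe
GENERATED by the gate from the ledger (D-0016/17). Provers cite these decls: `theorem foo : Summit.AtomisticToContinuum.BoseEinsteinCondensation.Theses.BECSwapNoCatastrophe.<Decl> := …` in Summits/AtomisticToContinuum/BoseEinsteinCondensation/Theorems/<Name>.lean.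
-/

namespace Summit.AtomisticToContinuum.BoseEinsteinCondensation.Theses.BECSwapNoCatastrophe

open scoped BigOperators Topology Manifold Classical MeasureTheory ProbabilityTheory Matrix InnerProductSpace ComplexConjugate ContinuousMap
open Filter Set Function TopologicalSpace MeasureTheory

attribute [summit_statement] _root_.BoseEinsteinCondensation

/-- item stmt-AtomisticToContinuum-14392 · target · rank 0 · open · by planner
why it might fail: Near-minimiser-wise equivalent to mode-free torus BEC ((λ_max/N)² ≤ SWAP ≤ λ_max/N, PenroseOnsager1956 (5)): as strong as the T = 0 problem on the torus; all content sits in ranks 2–3; needs E₀^per < ⊤ eventually (true below close packing).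
sources: PenroseOnsager1956, ZozulyaHaqueSchoutens2008, HerdmanEtAl2014, LiebSeiringerSolovejYngvason2005, Fournais2020
[target] X as in § Thesis: uniform lower bound c > 0 on the swap purity tr(γ_Ψ²)/N² = swapPurity n
(1_cell^N · Ψ.ψ) of δ-near-minimisers of the periodic (n+1)-boson energy on the torus of side
((n+1)/ρ)^(1/3), every repulsive finite-range v (hard cores included), all small ρ, all large n, δ
after n. Reached from rank 2 by MidpointLemma; feeds PeriodicBEC through SwapToZeroMode. -/
@[route_item "route-AtomisticToContinuum-BECSwapNoCatastrophe"]
def TorusSwapBound : Prop :=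
  ∀ v : ℝ → ENNReal, Literature.MathematicalPhysics.QuantumManyBody.BoseGas.IsRepulsiveFiniteRange v → ∃ ρ₀ : ℝ, 0 < ρ₀ ∧ ∀ ρ : ℝ, 0 < ρ → ρ < ρ₀ → ∃ c : ℝ, 0 < c ∧ ∀ᶠ n : ℕ in Filter.atTop, ∃ δ : ENNReal, 0 < δ ∧ ∀ Ψ : Literature.MathematicalPhysics.QuantumManyBody.BoseGas.PeriodicTrialState (n + 1) (Literature.MathematicalPhysics.QuantumManyBody.BoseGas.sideLength ρ (n + 1)), Literature.MathematicalPhysics.QuantumManyBody.BoseGas.periodicEnergy v Ψ ≤ Literature.MathematicalPhysics.QuantumManyBody.BoseGas.periodicGroundStateEnergy v (n + 1) (Literature.MathematicalPhysics.QuantumManyBody.BoseGas.sideLength ρ (n + 1)) + δ → ENNReal.ofReal c ≤ Literature.MathematicalPhysics.QuantumManyBody.BoseGas.swapPurity n ((Literature.MathematicalPhysics.QuantumManyBody.BoseGas.cellN (n + 1) (Literature.MathematicalPhysics.QuantumManyBody.BoseGas.sideLength ρ (n + 1))).indicator Ψ.ψ)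

/-- item stmt-AtomisticToContinuum-14393 · crux · rank 2 · open · by planner
why it might fail: No uniform-in-N control of an overlap of 2N-body ground states differing by an O(1) local two-body defect exists for an interacting continuum gas (two gapless baths); a v-dependent O(1) deficit surviving ρ → 0 (UV of the half-coupled pair; hard cores: midpoint impurity energy 2μ) breaks the ½.
sources: Anderson1967, GebertKuttlerMuller2014, SunRambowSi2004, GuentherEtAl2021, EisenbergLieb2002, PenroseOnsager1956
[crux] THE HALF-SWAPPED TORUS GROUND STATE REMEMBERS THE PRODUCT (card S2, integrated AOC form, all
v incl. hard cores). Two copies of the torus (ℝ³/Lℤ³)^N, N = n+1, L = (N/ρ)^(1/3); tag particle 0 of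
each copy (a = x₀, b = y₀). E2 = the two-copy periodic quadratic form on the cell [0,L)^(3N) ×
[0,L)^(3N) with bath–bath interactions v^per inside each copy and each tagged particle coupled at
HALF strength to BOTH baths (Σ_j ½[v^per(a−x_j) + v^per(b−y_j) + v^per(b−x_j) + v^per(a−y_j)], ½·⊤ =
⊤), over the admissible class Adm = {Θ : C¹, Lℤ³-periodic in every coordinate of both copies,
F-symmetric (Θ∘F = Θ, F : x₀ ↔ y₀), ∫_cell² |Θ|² = 1}. Claim: ∃ρ₀(v) ∀ρ ∈ (0,ρ₀) ∃η > 0 ∀ᶠn ∃δ > 0: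
every periodic δ-near-minimiser Ψ of the one-copy energy and every δ-near-minimiser Θ of E2 within
Adm satisfy |⟨Θ, Ψ⊗Ψ⟩_cell²|² ≥ ½ + η. Ground-state reading: α² = |⟨Ψ₀⊗Ψ₀, Φ(½)⟩|² > ½ uniformly in
N (two independent condensates vs. one pair shared half–half cannot be told apart; expected 1 − α² =
O(C(v)√(ρa³))). Implied by rank 3 for bounded v (chord s = 0 → ½, bosonic = absolute infimum, Ψ⊗Ψ a
2δ-near-minimiser of E2(0)). [difficulty: open-problem] -/
@[route_item "route-AtomisticToContinuum-BECSwapNoCatastrophe", crux]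
def TorusHalfSwapOverlap : Prop :=
  ∀ v : ℝ → ENNReal, Literature.MathematicalPhysics.QuantumManyBody.BoseGas.IsRepulsiveFiniteRange v → ∃ ρ₀ : ℝ, 0 < ρ₀ ∧ ∀ ρ : ℝ, 0 < ρ → ρ < ρ₀ → ∃ η : ℝ, 0 < η ∧ ∀ᶠ n : ℕ in Filter.atTop, let L : ℝ := Literature.MathematicalPhysics.QuantumManyBody.BoseGas.sideLength ρ (n + 1); let C2 : Set (Literature.MathematicalPhysics.QuantumManyBody.BoseGas.Config (n + 1) × Literature.MathematicalPhysics.QuantumManyBody.BoseGas.Config (n + 1)) := (Literature.MathematicalPhysics.QuantumManyBody.BoseGas.cellN (n + 1) L) ×ˢ (Literature.MathematicalPhysics.QuantumManyBody.BoseGas.cellN (n + 1) L); let E2 : (Literature.MathematicalPhysics.QuantumManyBody.BoseGas.Config (n + 1) × Literature.MathematicalPhysics.QuantumManyBody.BoseGas.Config (n + 1) → ℂ) → ENNReal := fun Θ => ∫⁻ Z in C2, (Literature.MathematicalPhysics.QuantumManyBody.BoseGas.kineticDensity (fun X => Θ (X, Z.2)) Z.1 + Literature.MathematicalPhysics.QuantumManyBody.BoseGas.kineticDensity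 (fun Y => Θ (Z.1, Y)) Z.2 + (Literature.MathematicalPhysics.QuantumManyBody.BoseGas.periodicInteraction v L (Fin.tail Z.1) + Literature.MathematicalPhysics.QuantumManyBody.BoseGas.periodicInteraction v L (Fin.tail Z.2) + ∑ j : Fin n, (2 : ENNReal)⁻¹ * (Literature.MathematicalPhysics.QuantumManyBody.BoseGas.periodizedPotential v L (Z.1 0 - Z.1 j.succ) + Literature.MathematicalPhysics.QuantumManyBody.BoseGas.periodizedPotential v L (Z.2 0 - Z.2 j.succ) + Literature.MathematicalPhysics.QuantumManyBody.BoseGas.periodizedPotential v L (Z.2 0 - Z.1 j.succ) + Literature.MathematicalPhysics.QuantumManyBody.BoseGas.periodizedPotential v L (Z.1 0 - Z.2 j.succ))) * (‖Θ Z‖₊ : ENNReal) ^ 2); let Adm : (Literature.MathematicalPhysics.QuantumManyBody.BoseGas.Config (n + 1) × Literature.MathematicalPhysics.QuantumManyBody.BoseGas.Config (n + 1) → ℂ) → Prop := fun Θ => ContDiff ℝ 1 Θ ∧ (∀ (Z : Literature.MathematicalPhysics.QuantumManyBody.BoseGas.Config (n + 1) × Literature.MathematicalPhysics.QuantumManyBody.BoseGas.Config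 (n + 1)) (i : Fin (n + 1)) (k : Fin 3), Θ (Z.1 + Pi.single i (EuclideanSpace.single k L), Z.2) = Θ Z ∧ Θ (Z.1, Z.2 + Pi.single i (EuclideanSpace.single k L)) = Θ Z) ∧ (∀ X Y : Literature.MathematicalPhysics.QuantumManyBody.BoseGas.Config (n + 1), Θ (Matrix.vecCons (Y 0) (Fin.tail X), Matrix.vecCons (X 0) (Fin.tail Y)) = Θ (X, Y)) ∧ ∫⁻ Z in C2, (‖Θ Z‖₊ : ENNReal) ^ 2 = 1; ∃ δ : ENNReal, 0 < δ ∧ ∀ Ψ : Literature.MathematicalPhysics.QuantumManyBody.BoseGas.PeriodicTrialState (n + 1) L, Literature.MathematicalPhysics.QuantumManyBody.BoseGas.periodicEnergy v Ψ ≤ Literature.MathematicalPhysics.QuantumManyBody.BoseGas.periodicGroundStateEnergy v (n + 1) L + δ → ∀ Θ : Literature.MathematicalPhysics.QuantumManyBody.BoseGas.Config (n + 1) × Literature.MathematicalPhysics.QuantumManyBody.BoseGas.Config (n + 1) → ℂ, Adm Θ → E2 Θ ≤ (⨅ (Θ' : Literature.MathematicalPhysics.QuantumManyBody.BoseGas.Config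 (n + 1) × Literature.MathematicalPhysics.QuantumManyBody.BoseGas.Config (n + 1) → ℂ) (_ : Adm Θ'), E2 Θ') + δ → ENNReal.ofReal (1 / 2 + η) ≤ (‖∫ Z in C2, (starRingEnd ℂ) (Θ Z) * (Ψ.ψ Z.1 * Ψ.ψ Z.2)‖₊ : ENNReal) ^ 2

/-- item stmt-AtomisticToContinuum-14394 · crux · rank 3 · open · by planner
why it might fail: Asserts sup_s χ_F(s) → 0 as ρ → 0 uniformly in N: needs inverse-square spectral moments of density fluctuations down to k = 2π/L (S(k) ≲ k and a Landau floor ω(k) ≳ k, open beyond GP scaling: Seiringer2011) plus domination beyond second order; finiteness is Bogoliubov-level only (SunRambowSi2004).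
sources: Anderson1967, GebertKuttlerMuller2014, GebertEtAl2016, ZanardiPaunkovic2006, Gu2010, SunRambowSi2004
[crux] NO ORTHOGONALITY CATASTROPHE ALONG THE TORUS SWAP PATH (card S2/S3 in fidelity form; bounded
finite-range v, for which the path is non-degenerate). Same two-copy torus; for s ∈ [0,1] let E2(s)
be the periodic form with bath–bath interactions plus Σ_j (1−s)[v^per(a−x_j) + v^per(b−y_j)] +
s[v^per(b−x_j) + v^per(a−y_j)] (H(0) = H⊕H, H(1) = F H(0) F, F H(s) F = H(1−s), all stoquastic), Adm
= {C¹, periodic in both copies, normalised on cell²}. Claim: ∀ε > 0 ∃ρ₀(ε,v) ∀ρ ∈ (0,ρ₀) ∀ᶠn ∀s,s′ ∈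
[0,1] ∀τ > 0 ∃δ > 0: δ-near-minimisers Θ of E2(s) and Θ′ of E2(s′) in Adm satisfy |⟨Θ,Θ′⟩_cell²|² ≥
1 − ε(s−s′)² − τ. Ground-state reading: the positive ground states Φ(s) move with Fubini–Study speed
≤ √ε, i.e. sup_s χ_F(s) ≤ ε for ρ < ρ₀(ε) UNIFORMLY IN N (Bogoliubov count: χ_F = O((∫v)²√(ρ/a)),
small-k integrand ∝ k dk in d = 3, dk/k in d = 1; see § Cheapest falsifier). At (s,s′) = (0,1):
SWAP(Ψ₀)² ≥ 1 − ε — complete condensation as ρ → 0. [difficulty: open-problem] -/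
@[route_item "route-AtomisticToContinuum-BECSwapNoCatastrophe", crux]
def TorusSwapPathRigidity : Prop :=
  ∀ v : ℝ → ENNReal, Literature.MathematicalPhysics.QuantumManyBody.BoseGas.IsRepulsiveFiniteRange v → (∃ M : NNReal, ∀ r, v r ≤ M) → ∀ ε : ℝ, 0 < ε → ∃ ρ₀ : ℝ, 0 < ρ₀ ∧ ∀ ρ : ℝ, 0 < ρ → ρ < ρ₀ → ∀ᶠ n : ℕ in Filter.atTop, let L : ℝ := Literature.MathematicalPhysics.QuantumManyBody.BoseGas.sideLength ρ (n + 1); let C2 : Set (Literature.MathematicalPhysics.QuantumManyBody.BoseGas.Config (n + 1) × Literature.MathematicalPhysics.QuantumManyBody.BoseGas.Config (n + 1)) := (Literature.MathematicalPhysics.QuantumManyBody.BoseGas.cellN (n + 1) L) ×ˢ (Literature.MathematicalPhysics.QuantumManyBody.BoseGas.cellN (n + 1) L); let E2 : ℝ → (Literature.MathematicalPhysics.QuantumManyBody.BoseGas.Config (n + 1) × Literature.MathematicalPhysics.QuantumManyBody.BoseGas.Config (n + 1) → ℂ) → ENNReal := fun s Θ => ∫⁻ Z in C2, (Literature.MathematicalPhysics.QuantumManyBody.BoseGas.kineticDensity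 (fun X => Θ (X, Z.2)) Z.1 + Literature.MathematicalPhysics.QuantumManyBody.BoseGas.kineticDensity (fun Y => Θ (Z.1, Y)) Z.2 + (Literature.MathematicalPhysics.QuantumManyBody.BoseGas.periodicInteraction v L (Fin.tail Z.1) + Literature.MathematicalPhysics.QuantumManyBody.BoseGas.periodicInteraction v L (Fin.tail Z.2) + ∑ j : Fin n, (ENNReal.ofReal (1 - s) * (Literature.MathematicalPhysics.QuantumManyBody.BoseGas.periodizedPotential v L (Z.1 0 - Z.1 j.succ) + Literature.MathematicalPhysics.QuantumManyBody.BoseGas.periodizedPotential v L (Z.2 0 - Z.2 j.succ)) + ENNReal.ofReal s * (Literature.MathematicalPhysics.QuantumManyBody.BoseGas.periodizedPotential v L (Z.2 0 - Z.1 j.succ) + Literature.MathematicalPhysics.QuantumManyBody.BoseGas.periodizedPotential v L (Z.1 0 - Z.2 j.succ)))) * (‖Θ Z‖₊ : ENNReal) ^ 2); let Adm : (Literature.MathematicalPhysics.QuantumManyBody.BoseGas.Config (n + 1) × Literature.MathematicalPhysics.QuantumManyBody.BoseGas.Config (n + 1) → ℂ) → Prop := fun Θ => ContDiff ℝ 1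 Θ ∧ (∀ (Z : Literature.MathematicalPhysics.QuantumManyBody.BoseGas.Config (n + 1) × Literature.MathematicalPhysics.QuantumManyBody.BoseGas.Config (n + 1)) (i : Fin (n + 1)) (k : Fin 3), Θ (Z.1 + Pi.single i (EuclideanSpace.single k L), Z.2) = Θ Z ∧ Θ (Z.1, Z.2 + Pi.single i (EuclideanSpace.single k L)) = Θ Z) ∧ ∫⁻ Z in C2, (‖Θ Z‖₊ : ENNReal) ^ 2 = 1; ∀ s : ℝ, 0 ≤ s → s ≤ 1 → ∀ s' : ℝ, 0 ≤ s' → s' ≤ 1 → ∀ τ : ℝ, 0 < τ → ∃ δ : ENNReal, 0 < δ ∧ ∀ Θ Θ' : Literature.MathematicalPhysics.QuantumManyBody.BoseGas.Config (n + 1) × Literature.MathematicalPhysics.QuantumManyBody.BoseGas.Config (n + 1) → ℂ, Adm Θ → Adm Θ' → E2 s Θ ≤ (⨅ (Θ'' : Literature.MathematicalPhysics.QuantumManyBody.BoseGas.Config (n + 1) × Literature.MathematicalPhysics.QuantumManyBody.BoseGas.Config (n + 1) → ℂ) (_ : Adm Θ''), E2 s Θ'') + δ → E2 s' Θ' ≤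 (⨅ (Θ'' : Literature.MathematicalPhysics.QuantumManyBody.BoseGas.Config (n + 1) × Literature.MathematicalPhysics.QuantumManyBody.BoseGas.Config (n + 1) → ℂ) (_ : Adm Θ''), E2 s' Θ'') + δ → ENNReal.ofReal (1 - ε * (s - s') ^ 2 - τ) ≤ (‖∫ Z in C2, (starRingEnd ℂ) (Θ Z) * Θ' Z‖₊ : ENNReal) ^ 2

/-- item stmt-AtomisticToContinuum-14395 · crux · rank 4 · open · by planner
why it might fail: Finite residue is Bogoliubov-level only (SunRambowSi2004 eq. (22); GuentherEtAl2021): the ideal gas HAS a catastrophe (overlap e^(−λN^(1/3))), so a proof must use S(k) ≲ k/c of the interacting state down to k = 2π/L — an O(1)-precision response bound inside an O(N) energy; none exists.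
sources: SunRambowSi2004, GuentherEtAl2021, MysliwySeiringer2020, LampartTriay2025, AstrakharchikPitaevskii2004, PitaevskiiStringari1991
[crux] FIRST RUNG: NO CATASTROPHE FOR A PINNED SCATTERER IN THE DILUTE INTERACTING TORUS GAS,
UNIFORMLY IN THE VOLUME (bounded finite-range v). One copy, N bosons on the torus of side
(N/ρ)^(1/3), plus a static impurity at z coupled through the SAME pair potential with strength t:
E_t(Φ) = periodicEnergy v Φ + t ∫_cell Σ_j v^per(x_j − z)|Φ|² (impurityInteraction of
PeriodicBoseGasImpurity). Claim: ∀ε > 0 ∃ρ₀(ε,v) ∀ρ ∈ (0,ρ₀) ∀ᶠN ∀z ∀t,t′ ∈ [0,1] ∀τ > 0 ∃δ > 0: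
δ-near-minimisers Φ of E_t and Φ′ of E_t′ (periodic trial states) satisfy |⟨Φ,Φ′⟩_cell|² ≥ 1 −
ε(t−t′)² − τ. Ground-state reading: the infinite-mass Bose-polaron residue Z_N(t) → 1 as ρ → 0
uniformly in N (one-loop exponent ρ∫d³k |v̂|² S/ω² ∝ (∫v)²√(ρ/a) in d = 3; it DIVERGES for the ideal
gas, whose overlap is e^(−λN^(1/3))). Worst case of the engine (no recoil, one bath): the test-bed
for ranks 2–3, not on the deciding chain. [difficulty: XL] -/
@[route_item "route-AtomisticToContinuum-BECSwapNoCatastrophe"]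
def TorusStaticImpurityRigidity : Prop :=
  ∀ v : ℝ → ENNReal, Literature.MathematicalPhysics.QuantumManyBody.BoseGas.IsRepulsiveFiniteRange v → (∃ M : NNReal, ∀ r, v r ≤ M) → ∀ ε : ℝ, 0 < ε → ∃ ρ₀ : ℝ, 0 < ρ₀ ∧ ∀ ρ : ℝ, 0 < ρ → ρ < ρ₀ → ∀ᶠ N : ℕ in Filter.atTop, let L : ℝ := Literature.MathematicalPhysics.QuantumManyBody.BoseGas.sideLength ρ N; let Et : Literature.MathematicalPhysics.QuantumManyBody.BoseGas.Space → ℝ → Literature.MathematicalPhysics.QuantumManyBody.BoseGas.PeriodicTrialState N L → ENNReal := fun z t Φ => Literature.MathematicalPhysics.QuantumManyBody.BoseGas.periodicEnergy v Φ + ENNReal.ofReal t * ∫⁻ X in Literature.MathematicalPhysics.QuantumManyBody.BoseGas.cellN N L, Literature.MathematicalPhysics.QuantumManyBody.BoseGas.impurityInteraction v L z X * (‖Φ.ψ X‖₊ : ENNReal) ^ 2; ∀ z : Literature.MathematicalPhysics.QuantumManyBody.BoseGas.Space, ∀ t : ℝ, 0 ≤ t → t ≤ 1 → ∀ t' : ℝ,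 0 ≤ t' → t' ≤ 1 → ∀ τ : ℝ, 0 < τ → ∃ δ : ENNReal, 0 < δ ∧ ∀ Φ Φ' : Literature.MathematicalPhysics.QuantumManyBody.BoseGas.PeriodicTrialState N L, Et z t Φ ≤ (⨅ Φ'' : Literature.MathematicalPhysics.QuantumManyBody.BoseGas.PeriodicTrialState N L, Et z t Φ'') + δ → Et z t' Φ' ≤ (⨅ Φ'' : Literature.MathematicalPhysics.QuantumManyBody.BoseGas.PeriodicTrialState N L, Et z t' Φ'') + δ → ENNReal.ofReal (1 - ε * (t - t') ^ 2 - τ) ≤ (‖∫ X in Literature.MathematicalPhysics.QuantumManyBody.BoseGas.cellN N L, (starRingEnd ℂ) (Φ.ψ X) * Φ'.ψ X‖₊ : ENNReal) ^ 2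

/-- item stmt-AtomisticToContinuum-0827 · crux · rank 5 · open · by planner
why it might fail: Torus hypothesis never fires on the Dirichlet ground state (wall energy ≫ δ above E₀^per; interior restrictions not periodic/sharp-N): no energy comparison; print transfers only the ENERGY across b.c. (LSSY2005 Ch. 2) — a condensate transfer is not in print; BEC is b.c.-sensitive (Robinson1976).
sources: LiebSeiringerSolovejYngvason2005, Junge2026, BoccatoSeiringer2023, Basti2022, Robinson1976
[crux] BoundaryTransferWeak (mode-free boundary-condition transfer, per potential): for each
repulsive finite-range v, PeriodicBEC(v) implies ∃ρ₀>0 ∀ρ∈(0,ρ₀) HasGroundStateBEC v ρ (Dirichlet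
ground state, λ_max(γ) ≥ cN via condensateNumber). Not glue: near-minimiser slacks are O(N/L²) while
Dirichlet/periodic energies differ by a boundary term ≫ N/L², so no energy-comparison proof;
expected route: Neumann bracketing of interior sub-boxes (−Δ_Dir ≥ ⊕−Δ_Neu, v ≥ 0) + a mode-free
criterion (λ_max ≥ tr γ²/N). Only the ENERGY analogue is in print (LiebSeiringerSolovejYngvason2005
Ch. 2 after (2.8)). v ≡ 0: hypothesis and conclusion both true. -/
@[route_item "route-AtomisticToContinuum-BECSwapNoCatastrophe", crux]
def BoundaryTransferWeak : Prop :=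
  ∀ v : ℝ → ENNReal, Literature.MathematicalPhysics.QuantumManyBody.BoseGas.IsRepulsiveFiniteRange v → (∃ ρ₀ : ℝ, 0 < ρ₀ ∧ ∀ ρ : ℝ, 0 < ρ → ρ < ρ₀ → ∃ c : ℝ, 0 < c ∧ ∀ᶠ N : ℕ in Filter.atTop, ∃ δ : ENNReal, 0 < δ ∧ ∀ Ψ : Literature.MathematicalPhysics.QuantumManyBody.BoseGas.PeriodicTrialState N (Literature.MathematicalPhysics.QuantumManyBody.BoseGas.sideLength ρ N), Literature.MathematicalPhysics.QuantumManyBody.BoseGas.periodicEnergy v Ψ ≤ Literature.MathematicalPhysics.QuantumManyBody.BoseGas.periodicGroundStateEnergy v N (Literature.MathematicalPhysics.QuantumManyBody.BoseGas.sideLength ρ N) + δ → ENNReal.ofReal (c * N) ≤ Literature.MathematicalPhysics.QuantumManyBody.BoseGas.condensateOccupation N (Literature.MathematicalPhysics.QuantumManyBody.BoseGas.sideLength ρ N) Ψ.ψ) → ∃ ρ₀ : ℝ, 0 < ρ₀ ∧ ∀ ρ : ℝ, 0 < ρ → ρ < ρ₀ → Literature.MathematicalPhysics.QuantumManyBody.BoseGas.HasGroundStateBEC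 v ρ

/-- item stmt-AtomisticToContinuum-8958 · crux · rank 6 · open · by planner
why it might fail: Automatic for bounded v (positivity improving, ReedSimonIV1978 XIII.12/47), but for hard cores the torus hard-sphere configuration space may disconnect (sparse jammed frames wrapping the torus; Kahle2012, BaryshnikovBubenikKahle2013) unless caged components are excluded energetically.
sources: ReedSimonIV1978, Kahle2012, BaryshnikovBubenikKahle2013, LiebSeiringerSolovejYngvason2005
[crux] (card item PI4, torus twin of BECPalmLandscape.GroundStateRigidity =
stmt-AtomisticToContinuum-3298) ∀ admissible v ∃ρ₀ ∀ρ<ρ₀ ∀ᶠ N ∀η>0 ∃δ>0: any two periodic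
δ-near-minimisers Ψ, Φ ∈ PeriodicTrialState N L (L = (N/ρ)^{1/3}) satisfy ∫_{cell^N}|Ψ − cΦ|² ≤ η
for some unit complex c (E₀^per < ∞ at low density, compact resolvent of the torus N-body operator,
unique positive ground state by positivity improvement, spectral gap at fixed N; hard cores via
energetic dominance / connectivity of the dilute component of configuration space). [difficulty: M] -/
@[route_item "route-AtomisticToContinuum-BECSwapNoCatastrophe", crux]
def TorusPhaseRigidity : Prop :=
  ∀ v : ℝ → ENNReal, Literature.MathematicalPhysics.QuantumManyBody.BoseGas.IsRepulsiveFiniteRange v → ∃ ρ₀ : ℝ, 0 < ρ₀ ∧ ∀ ρ : ℝ, 0 < ρ → ρ < ρ₀ → ∀ᶠ N : ℕ in Filter.atTop, ∀ η : ℝ, 0 < η → ∃ δ : ENNReal, 0 < δ ∧ ∀ Ψ Φ : Literature.MathematicalPhysics.QuantumManyBody.BoseGas.PeriodicTrialState N (Literature.MathematicalPhysics.QuantumManyBody.BoseGas.sideLength ρ N), Literature.MathematicalPhysics.QuantumManyBody.BoseGas.periodicEnergy v Ψ ≤ Literature.MathematicalPhysics.QuantumManyBody.BoseGas.periodicGroundStateEnergy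 v N (Literature.MathematicalPhysics.QuantumManyBody.BoseGas.sideLength ρ N) + δ → Literature.MathematicalPhysics.QuantumManyBody.BoseGas.periodicEnergy v Φ ≤ Literature.MathematicalPhysics.QuantumManyBody.BoseGas.periodicGroundStateEnergy v N (Literature.MathematicalPhysics.QuantumManyBody.BoseGas.sideLength ρ N) + δ → ∃ c : ℂ, ‖c‖ = 1 ∧ ∫⁻ X in Literature.MathematicalPhysics.QuantumManyBody.BoseGas.cellN N (Literature.MathematicalPhysics.QuantumManyBody.BoseGas.sideLength ρ N), (‖Ψ.ψ X - c * Φ.ψ X‖₊ : ENNReal) ^ 2 ≤ ENNReal.ofReal η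

/-- item stmt-AtomisticToContinuum-14396 · support · rank 9 · closed · proved by Summit.AtomisticToContinuum.BoseEinsteinCondensation.Theorems.midpointLemma_proof (prover) · by planner
sources: PenroseOnsager1956, HerdmanEtAl2014
[support] TorusHalfSwapOverlap → TorusSwapBound (pure Hilbert-space algebra + Fubini). Fix v, ρ, η,
n, δ from rank 2; for a periodic δ-near-minimiser Ψ pick ONE F-symmetric δ-near-minimiser Θ of E2 in
Adm (exists: Adm ∋ the normalised constant, so either inf = ⊤ and any member works or iInf < iInf +
δ); with Φ = 1_cell²·Ψ⊗Ψ (unit vector by Fubini + norm_eq) and U : Θ ↦ Θ∘F a unitary self-adjoint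
involution of L²(cell²) (F measure-preserving), P = (1+U)/2: ⟨Φ,UΦ⟩ = 2‖PΦ‖² − 1 ≥ 2|⟨Θ,Φ⟩|² − 1 ≥
2η (Θ = PΘ unit), and ⟨Φ,UΦ⟩ = ∫∫|∫Ψ(x::X̂) conj Ψ(x::Ŷ) dx|² = swapPurity n (1_cell^N·Ψ.ψ)
(lintegral_config_succ, swapPurity_eq_lintegral_lintegral of SwapPurity.lean); c = 2η. [deps:
TorusHalfSwapOverlap, TorusSwapBound] [difficulty: M] -/
@[route_item "route-AtomisticToContinuum-BECSwapNoCatastrophe", crux]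
def MidpointLemma : Prop :=
  TorusHalfSwapOverlap → TorusSwapBound

-- `MidpointLemma` holds: proved by `Summit.AtomisticToContinuum.BoseEinsteinCondensation.Theorems.midpointLemma_proof` (its module imports this route file, so no `_holds` link can be stated here).

/-- item stmt-AtomisticToContinuum-14397 · support · rank 9 · closed · proved by Summit.AtomisticToContinuum.BoseEinsteinCondensation.Theorems.swapToZeroMode_proof (prover) · by planner
sources: PenroseOnsager1956, LiebSeiringerSolovejYngvason2005, Fournais2020
[support] TorusPhaseRigidity → TorusSwapBound → PeriodicBEC, the latter written out verbatim as the
body of the shared item stmt-AtomisticToContinuum-0826 (constant-mode occupation ≥ cN for periodic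
δ-near-minimisers; = the hypothesis of BoundaryTransferWeak) so that the file order is immaterial
(mode-free → constant mode at fixed N; operator-free, inputs in tree or elementary). For large N =
n+1 with c, δ₁ from X, δ(η) from rigidity, η = (c/8)²: (1) a NONNEGATIVE periodic near-minimiser Φ₊
exists at every slack (diamagnetic smoothing |Ψ|²/(|Ψ|²+ε²)^(1/2) renormalised: C¹, periodic,
symmetric, vanishes where Ψ does, kinetic term → ∫|∇|Ψ||² ≤ ∫|∇Ψ|² at fixed N); (2) translates of Φ₊
are near-minimisers (periodicEnergy_translate, PROVED), so rigidity gives ‖T_tΦ₊ − c_tΦ₊‖² ≤ η ∀t;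
(3) for every normalised mode φ, occupation(T_tφ,Φ₊)^(1/2) ≥ occupation(φ,Φ₊)^(1/2) − √(Nη), and the
t-average of occupation(T_tφ,Φ₊) is ⟨φ,γ̄φ⟩, γ̄ = translation average of γ_Φ₊ = convolution by ḡ ≥ 0
(Φ₊ ≥ 0) with ĝ(k) ≤ ĝ(0) = condensateOccupation(Φ₊); sup over φ and P–O II
(succ_mul_swapPurity_le_maxOccupation, PROVED) give n₀(Φ₊) ≥ (√λ_max − √(Nη))² ≥ N(c − 2√η); (4) any
δ-near-minimiser Ψ is η-close t -/
@[route_item "route-AtomisticToContinuum-BECSwapNoCatastrophe", crux]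
def SwapToZeroMode : Prop :=
  TorusPhaseRigidity → TorusSwapBound → ∀ v : ℝ → ENNReal, Literature.MathematicalPhysics.QuantumManyBody.BoseGas.IsRepulsiveFiniteRange v → ∃ ρ₀ : ℝ, 0 < ρ₀ ∧ ∀ ρ : ℝ, 0 < ρ → ρ < ρ₀ → ∃ c : ℝ, 0 < c ∧ ∀ᶠ N : ℕ in Filter.atTop, ∃ δ : ENNReal, 0 < δ ∧ ∀ Ψ : Literature.MathematicalPhysics.QuantumManyBody.BoseGas.PeriodicTrialState N (Literature.MathematicalPhysics.QuantumManyBody.BoseGas.sideLength ρ N), Literature.MathematicalPhysics.QuantumManyBody.BoseGas.periodicEnergy v Ψ ≤ Literature.MathematicalPhysics.QuantumManyBody.BoseGas.periodicGroundStateEnergy v N (Literature.MathematicalPhysics.QuantumManyBody.BoseGas.sideLength ρ N) + δ → ENNReal.ofReal (c * N) ≤ Literature.MathematicalPhysics.QuantumManyBody.BoseGas.condensateOccupation N (Literature.MathematicalPhysics.QuantumManyBody.BoseGas.sideLength ρ N) Ψ.ψ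

-- `SwapToZeroMode` holds: proved by `Summit.AtomisticToContinuum.BoseEinsteinCondensation.Theorems.swapToZeroMode_proof` (its module imports this route file, so no `_holds` link can be stated here).

/-- item stmt-AtomisticToContinuum-14398 · assembly · rank 1 · closed · proved by Summit.AtomisticToContinuum.BoseEinsteinCondensation.Theorems.becSwapNoCatastrophe_assembly_proof (prover) · by planner
sources: PenroseOnsager1956, LiebSeiringerSolovejYngvason2005
[assembly] TorusHalfSwapOverlap → MidpointLemma → TorusPhaseRigidity → SwapToZeroMode →
BoundaryTransferWeak → BoseEinsteinCondensation (the sub-problem Statement abbrev). -/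
@[route_item "route-AtomisticToContinuum-BECSwapNoCatastrophe"]
def Assembly : Prop :=
  TorusHalfSwapOverlap → MidpointLemma → TorusPhaseRigidity → SwapToZeroMode → BoundaryTransferWeak → BoseEinsteinCondensation

-- `Assembly` holds: proved by `Summit.AtomisticToContinuum.BoseEinsteinCondensation.Theorems.becSwapNoCatastrophe_assembly_proof` (its module imports this route file, so no `_holds` link can be stated here).

/-! D-0027 §2.1 — DECIDING THEOREM (planner-authored via `route open/edit --closes-file`; by planner-rbadge-AtomisticToContinuum-BECSwapNoC-3b4174fd-0 2026-08-15T19:44:39Z):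
its hypotheses are this route's items and its conclusion the sub-problem Statement (glue_lint), and it elaborates with this file. -/

@[closes "route-AtomisticToContinuum-BECSwapNoCatastrophe"] theorem closes (h2 : TorusHalfSwapOverlap) (hM : MidpointLemma) (h6 : TorusPhaseRigidity)
    (hZ : SwapToZeroMode) (h5 : BoundaryTransferWeak) : _root_.BoseEinsteinCondensation :=
  fun v hv => h5 v hv ((hZ h6 (hM h2)) v hv)

end Summit.AtomisticToContinuum.BoseEinsteinCondensation.Theses.BECSwapNoCatastrophe
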